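import Literature.MathematicalPhysics.QuantumLattice.DWaveSourceChordCertificate
import HarnessLib

/-!
# The mean-energy observable of the pair source IS the local pair at the origin plus its adjoint:
# `Γ E_P = Γ P₀^g + (Γ P₀^g)ᴴ` as window operators; hence `Γ E^{src}_{h₁} − Γ E^{src}_h = (h − h₁)(Γ P₀ + (Γ P₀)ᴴ)`
# and the chord certificate with the certificates' OWN pair objective

Topic `Literature/MathematicalPhysics/QuantumLattice` (namespace = path); cell `hubbard-cq`, seat `hubbard-cq-obsth-1`
(row «pinning-field K5 menu nodes with the pinning term»). Companion of `DWaveSourceChordCertificate` (the chord certificate with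
objective `(h − h₁) • Γ E_P`) and of the node-shape files, whose pair objective is `Γ_{Λ'} P₀^d + (Γ_{Λ'} P₀^d)ᴴ`
(`P₀^d = localPairAt ({0} ∪ unitSteps) dWaveFormFactor 0`). `TIGroundEnergyDensityResponse` §8 proves the EXPECTATION identity
`e_P(ω) = 2 Re ω(P₀)`; here the OPERATOR identity behind it:

* §1 `fermionEmbed_meanEnergyObs_pairSource_eq_localPairAt_add_conjTranspose` — for a form factor even on the unit steps and every
  window `Λ' ⊇ thicken {0} 1`: `Γ ((pairSourceInteraction g).meanEnergyObs 1) = Γ P₀^g + (Γ P₀^g)ᴴ`. The mean-energy observable spreads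
  each bond `{0, ±eᵢ}` over its two ends with weight `½` (`pairSourceInteraction_meanEnergyObs`: `Γ Φ{0} + Σᵢ ½(Γ Φ{0,eᵢ} + Γ Φ{−eᵢ,0})`,
  `Φ{x,x+eᵢ} = √2 g(eᵢ)(b + bᴴ)`), the local pair collects the oriented bonds out of the origin with weight `g(e)/√2`
  (`b_{0,−eᵢ} = b_{−eᵢ,0}` by the singlet symmetry); `½·√2 = 1/√2` matches them — so NO translation-defect rows are needed to pass
  between the engine's pair word at the origin and the tree's sourced energy observable (CONSUMER-GRAMMAR §9 note, now sharpened).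
* §2 `fermionEmbed_meanEnergyObs_sourced_eq_sub_smul_localPairAt`: `Γ E^{src}_{μ,h} = Γ E^{src}_{μ,0} − h • (Γ P₀^d + (Γ P₀^d)ᴴ)` and
  `fermionEmbed_meanEnergyObs_sourced_sub_eq_smul_localPairAt`: `Γ E^{src}_{h₁} − Γ E^{src}_{h} = (h − h₁) • (Γ P₀^d + (Γ P₀^d)ᴴ)`.
* §3 the RIGHT chord (ceiling side) WITH THE PAIR OBJECTIVE of the node-shape files (MAX program `−(Γ P₀^d + (Γ P₀^d)ᴴ)`, cap row
  at `h`, floor row at a LARGER field `h₂`, multipliers `1/(h₂ − h)`, `c = (ℓ₂ − u)/(h₂ − h)`, empty Gram / eom / defect / kkt blocks;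
  the identity is PROVED), through `IsMeanEnergyMinimiser.re_sum_twistedFlipAct_expect_ge_of_sourced_certificate_kkt_fieldRows`:
  `−∂⁺E(h) ≤ (u − ℓ₂)/(h₂ − h)` (`neg_rightDeriv_le_div_of_pair_chord_certificate`; the floor side with the energy objective is
  `DWaveSourceChordCertificate`) — the pair-objective node shapes are non-vacuous and their constants reproduce Griffiths' ceiling.

HONEST FRAMING (cell hubbard-cq): operator bookkeeping + a consistency instance; no number, no order parameter, no phase word. Everything is
PROVED; no definition, no named fact, no `sorry`. Tree search: `lean search 'meanEnergyObs_pairSource_eq|localPairAt_add_conjTranspose'` —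
only the expectation-level `re_expect_fermionEmbed_localPairAt_add_conjTranspose`; REUSED `pairSourceInteraction_meanEnergyObs`,
`pairSourceInteraction_apply_singleton/_pair`, `singletPairAt_comm/_congr`, `fermionEmbed_incl_singletPairAt`, `sum_unitSteps`.

References: T. Koma, H. Tasaki, J. Stat. Phys. 76 (1994) 745, §1 (the pair source `Δ + Δ†`) [cite: KomaTasaki1994, §1];
O. Bratteli, A. Kishimoto, D. W. Robinson, CMP 64 (1978) 41, §3 (mean energy functional) [cite: BratteliKishimotoRobinson1978, §3];
R. B. Griffiths, Phys. Rev. 152 (1966) 240, §II [cite: Griffiths1966, §II]; D. J. Scalapino, Phys. Rep. 250 (1995) 329, §2 [cite: Scalapino1995, §2].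
-/

noncomputable section

namespace Literature.MathematicalPhysics.QuantumLattice

open Matrix Finset Complex HubbardWave0 Literature.Probability.LatticeModels Set
open Literature.MathematicalPhysics.QuantumManyBody.StateRelaxation
open scoped ComplexOrder BigOperators

/-! ## §1 The operator identity -/

section Operator

variable (g : Site 2 → ℝ)

/-- `½ · (√2 a) = a/√2`. [folklore] -/
private theorem half_sqrt_two_mul (a : ℝ) : (2 : ℝ)⁻¹ * (Real.sqrt 2 * a) = a / Real.sqrt 2 := by
  have h2 : Real.sqrt 2 * Real.sqrt 2 = 2 := Real.mul_self_sqrt (by norm_num)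
  have hne : Real.sqrt 2 ≠ 0 := by positivity
  rw [eq_div_iff hne]
  calc (2 : ℝ)⁻¹ * (Real.sqrt 2 * a) * Real.sqrt 2 = (2 : ℝ)⁻¹ * (Real.sqrt 2 * Real.sqrt 2) * a := by ring
    _ = a := by rw [h2]; ring

/-- The complex form: `(2:ℂ)⁻¹ • ((√2 a : ℝ) : ℂ) • X = ((a/√2 : ℝ) : ℂ) • X`. [folklore] -/
private theorem half_smul_sqrt_two_smul {Λ' : Finset (Site 2)} (a : ℝ) (X : FermionOp Λ') :
    (2 : ℂ)⁻¹ • (((Real.sqrt 2 * a : ℝ) : ℂ) • X) = ((a / Real.sqrt 2 : ℝ) : ℂ) • X := by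
  rw [smul_smul, ← half_sqrt_two_mul]
  push_cast
  rfl

/-- `c • (B + Bᴴ) = c • B + (c • B)ᴴ` for a real scalar. [folklore] -/
private theorem real_smul_add_conjTranspose' {Λ' : Finset (Site 2)} (c : ℝ) (B : FermionOp Λ') :
    ((c : ℝ) : ℂ) • (B + Bᴴ) = ((c : ℝ) : ℂ) • B + (((c : ℝ) : ℂ) • B)ᴴ := by
  rw [smul_add, Matrix.conjTranspose_smul, Complex.star_def, Complex.conj_ofReal]

/-- **`Γ E_P = Γ P₀^g + (Γ P₀^g)ᴴ`**: in every window `Λ' ⊇ thicken {0} 1`, the embedded mean-energy observable of the pair-source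
interaction with a form factor even on the unit steps equals the embedded local pair at the origin plus its adjoint.
[cite: KomaTasaki1994, §1] [cite: BratteliKishimotoRobinson1978, §3] -/
theorem fermionEmbed_meanEnergyObs_pairSource_eq_localPairAt_add_conjTranspose (hg : ∀ i : Fin 2, g (-unitVec i) = g (unitVec i))
    {Λ' : Finset (Site 2)} (h0 : thicken ({0} : Finset (Site 2)) 1 ⊆ Λ') (hP : pairRegion (insert (0 : Site 2) unitSteps) 0 ⊆ Λ') :
    fermionEmbed (PolySite.incl h0) ((pairSourceInteraction g).meanEnergyObs 1) =
      fermionEmbed (PolySite.incl hP) (localPairAt (insert (0 : Site 2) unitSteps) g 0) +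
        (fermionEmbed (PolySite.incl hP) (localPairAt (insert (0 : Site 2) unitSteps) g 0))ᴴ := by
  classical
  have hz' : (0 : Site 2) ∈ Λ' := h0 (zero_mem_thicken_zero 1)
  have hei : ∀ i : Fin 2, (unitVec i : Site 2) ∈ Λ' := fun i => h0 (unitVec_mem_thicken_one i)
  have hnei : ∀ i : Fin 2, (-unitVec i : Site 2) ∈ Λ' := fun i => h0 (neg_unitVec_mem_thicken_one i)
  -- normal-form blocks
  set A0 : FermionOp Λ' := ((g 0 / Real.sqrt 2 : ℝ) : ℂ) • singletPairAt 0 0 hz' hz' with hA0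
  set Bp : Fin 2 → FermionOp Λ' := fun i =>
    ((g (unitVec i) / Real.sqrt 2 : ℝ) : ℂ) • singletPairAt 0 (unitVec i) hz' (hei i) with hBp
  set Bm : Fin 2 → FermionOp Λ' := fun i =>
    ((g (unitVec i) / Real.sqrt 2 : ℝ) : ℂ) • singletPairAt 0 (-unitVec i) hz' (hnei i) with hBm
  -- (1) the embedded local pair
  have hR : fermionEmbed (PolySite.incl hP) (localPairAt (insert (0 : Site 2) unitSteps) g 0) = A0 + ∑ i : Fin 2, (Bp i + Bm i) := by
    set T : Site 2 → FermionOp Λ' := fun e =>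
      if h : (0 : Site 2) + e ∈ Λ' then ((g e / Real.sqrt 2 : ℝ) : ℂ) • singletPairAt 0 (0 + e) hz' h else 0 with hT
    have h1 : fermionEmbed (PolySite.incl hP) (localPairAt (insert (0 : Site 2) unitSteps) g 0) =
        ∑ e ∈ insert (0 : Site 2) unitSteps, T e := by
      unfold localPairAt
      rw [map_sum, ← Finset.sum_attach (insert (0 : Site 2) unitSteps) T]
      refine Finset.sum_congr rfl fun e _ => ?_
      rw [hT]
      dsimp only
      rw [dif_pos (hP (add_mem_pairRegion 0 e.2)), map_smul, fermionEmbed_incl_singletPairAt]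
    have hT0 : T 0 = A0 := by
      have hmem : (0 : Site 2) + 0 ∈ Λ' := by rw [add_zero]; exact hz'
      rw [hT, hA0]
      dsimp only
      rw [dif_pos hmem, singletPairAt_congr hz' hmem hz' hz' rfl (add_zero _)]
    have hTp : ∀ i : Fin 2, T (unitVec i) = Bp i := by
      intro i
      have hmem : (0 : Site 2) + unitVec i ∈ Λ' := by rw [zero_add]; exact hei i
      rw [hT, hBp]
      dsimp only
      rw [dif_pos hmem, singletPairAt_congr hz' hmem hz' (hei i) rfl (zero_add _)]
    have hTm : ∀ i : Fin 2, T (-unitVec i) = Bm i := by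
      intro i
      have hmem : (0 : Site 2) + -unitVec i ∈ Λ' := by rw [zero_add]; exact hnei i
      rw [hT, hBm]
      dsimp only
      rw [dif_pos hmem, hg i, singletPairAt_congr hz' hmem hz' (hnei i) rfl (zero_add _)]
    rw [h1, Finset.sum_insert zero_not_mem_unitSteps, sum_unitSteps, Fin.sum_univ_two, hT0, ← hTp 0, ← hTm 0, ← hTp 1, ← hTm 1]
    simp only [unitVec]
    abel
  -- (2) the embedded mean-energy observable
  have hL : fermionEmbed (PolySite.incl h0) ((pairSourceInteraction g).meanEnergyObs 1) =
      (A0 + A0ᴴ) + ∑ i : Fin 2, ((Bp i + (Bp i)ᴴ) + (Bm i + (Bm i)ᴴ)) := by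
    rw [pairSourceInteraction_meanEnergyObs, map_add, map_sum]
    congr 1
    · rw [fermionEmbed_fermionEmbed, PolySite.incl_trans, pairSourceInteraction_apply_singleton, fermionEmbed_smul, fermionEmbed_add,
        fermionEmbed_conjTranspose, fermionEmbed_incl_singletPairAt, hA0]
      exact real_smul_add_conjTranspose' _ _
    · refine Finset.sum_congr rfl fun i _ => ?_
      rw [map_add, map_smul, map_smul, fermionEmbed_fermionEmbed, fermionEmbed_fermionEmbed, PolySite.incl_trans, PolySite.incl_trans,
        pairSourceInteraction_apply_pair g 0 i, pairSourceInteraction_apply_pair g (-unitVec i) i, fermionEmbed_smul, fermionEmbed_smul,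
        fermionEmbed_add, fermionEmbed_add, fermionEmbed_conjTranspose, fermionEmbed_conjTranspose, fermionEmbed_incl_singletPairAt,
        fermionEmbed_incl_singletPairAt, half_smul_sqrt_two_smul, half_smul_sqrt_two_smul, hBp, hBm]
      dsimp only
      have hmem1 : (0 : Site 2) + unitVec i ∈ Λ' := by rw [zero_add]; exact hei i
      have hmem2 : -unitVec i + unitVec i ∈ Λ' := by rw [neg_add_cancel]; exact hz'
      rw [singletPairAt_congr hz' hmem1 hz' (hei i) rfl (zero_add _),
        singletPairAt_congr (hnei i) hmem2 (hnei i) hz' rfl (neg_add_cancel _), singletPairAt_comm 0 (-unitVec i) hz' (hnei i)]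
      rw [real_smul_add_conjTranspose', real_smul_add_conjTranspose']
  rw [hL, hR]
  simp only [Matrix.conjTranspose_add, Matrix.conjTranspose_sum, Finset.sum_add_distrib]
  abel

end Operator

/-! ## §2 The sourced mean-energy observable and the local pair -/

/-- **`Γ E^{src}_{μ,h} = Γ E^{src}_{μ,0} − h • (Γ P₀^d + (Γ P₀^d)ᴴ)`** in every window `Λ' ⊇ thicken {0} 1`.
[cite: KomaTasaki1994, §1] -/
theorem fermionEmbed_meanEnergyObs_sourced_eq_sub_smul_localPairAt (t t' U μ h : ℝ) {Λ' : Finset (Site 2)}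
    (h0 : thicken ({0} : Finset (Site 2)) 1 ⊆ Λ') (hP : pairRegion (insert (0 : Site 2) unitSteps) 0 ⊆ Λ') :
    fermionEmbed (PolySite.incl h0) ((hubbardTTPrimeSourcedInteraction t t' U μ dWaveFormFactor h).meanEnergyObs 1) =
      fermionEmbed (PolySite.incl h0) ((hubbardTTPrimeSourcedInteraction t t' U μ dWaveFormFactor 0).meanEnergyObs 1) -
        (h : ℂ) • (fermionEmbed (PolySite.incl hP) (localPairAt (insert (0 : Site 2) unitSteps) dWaveFormFactor 0) +
          (fermionEmbed (PolySite.incl hP) (localPairAt (insert (0 : Site 2) unitSteps) dWaveFormFactor 0))ᴴ) := by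
  have hsub := fermionEmbed_meanEnergyObs_sourced_sub t t' U μ dWaveFormFactor h 0 h0
  rw [fermionEmbed_meanEnergyObs_pairSource_eq_localPairAt_add_conjTranspose dWaveFormFactor dWaveFormFactor_neg_unitVec h0 hP, sub_zero]
    at hsub
  rw [sub_eq_iff_eq_add] at hsub
  rw [hsub]
  module

/-- **`Γ E^{src}_{h₁} − Γ E^{src}_{h} = (h − h₁) • (Γ P₀^d + (Γ P₀^d)ᴴ)`** — the Griffiths chord at the level of window operators, in the
pair objective of the cell's node shapes. [cite: Griffiths1966, §II] [cite: KomaTasaki1994, §1] -/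
theorem fermionEmbed_meanEnergyObs_sourced_sub_eq_smul_localPairAt (t t' U μ h h₁ : ℝ) {Λ' : Finset (Site 2)}
    (h0 : thicken ({0} : Finset (Site 2)) 1 ⊆ Λ') (hP : pairRegion (insert (0 : Site 2) unitSteps) 0 ⊆ Λ') :
    fermionEmbed (PolySite.incl h0) ((hubbardTTPrimeSourcedInteraction t t' U μ dWaveFormFactor h₁).meanEnergyObs 1) -
        fermionEmbed (PolySite.incl h0) ((hubbardTTPrimeSourcedInteraction t t' U μ dWaveFormFactor h).meanEnergyObs 1) =
      ((h - h₁ : ℝ) : ℂ) • (fermionEmbed (PolySite.incl hP) (localPairAt (insert (0 : Site 2) unitSteps) dWaveFormFactor 0) +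
        (fermionEmbed (PolySite.incl hP) (localPairAt (insert (0 : Site 2) unitSteps) dWaveFormFactor 0))ᴴ) := by
  rw [fermionEmbed_meanEnergyObs_sourced_sub t t' U μ dWaveFormFactor h h₁ h0,
    fermionEmbed_meanEnergyObs_pairSource_eq_localPairAt_add_conjTranspose dWaveFormFactor dWaveFormFactor_neg_unitVec h0 hP]

/-! ## §3 The RIGHT chord (ceiling side) as a certificate with the pair objective -/

/-- **The right chord is a certificate with the certificates' own pair objective** (MAX program): for `h < h₂`, certified `E(h) ≤ u`
(cap row at the program's field `h`) and `ℓ₂ ≤ E(h₂)` (floor row at the LARGER field `h₂`), the identity of the field-rows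
ground-state-class reader with objective `−(Γ P₀^d + (Γ P₀^d)ᴴ)`, constant `c = (ℓ₂ − u)/(h₂ − h)`, cap and floor multipliers
`1/(h₂ − h)` and EVERY other block empty is PROVED here (via `fermionEmbed_meanEnergyObs_sourced_sub_eq_smul_localPairAt`), and the
reader returns Griffiths' ceiling on the largest ground-state pair amplitude: `−∂⁺E(h) ≤ (u − ℓ₂)/(h₂ − h)`,
`E = dWaveSourceEnergyDensityTT' t' U μ` (the tree's `pairAmplitude_le_div_of_bounds`, re-derived through the certificate machinery —
the pair-objective node shapes are non-vacuous). [cite: Griffiths1966, §II] [cite: KomaTasaki1994, §1] -/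
theorem neg_rightDeriv_le_div_of_pair_chord_certificate (t' U μ h : ℝ) {h₂ u ℓ₂ : ℝ} (hh : h < h₂)
    (hu : dWaveSourceEnergyDensityTT' t' U μ h ≤ u) (hℓ : ℓ₂ ≤ dWaveSourceEnergyDensityTT' t' U μ h₂) :
    -derivWithin (dWaveSourceEnergyDensityTT' t' U μ) (Ioi h) h ≤ (u - ℓ₂) / (h₂ - h) := by
  obtain ⟨ω₀, hmin, hω₀⟩ := exists_isMeanEnergyMinimiser_two_mul_re_expect_localPairAt_eq_neg_rightDeriv t' U μ h
  set T : Finset (Site 2) := thicken ({0} : Finset (Site 2)) 1 with hT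
  have h0 : thicken ({0} : Finset (Site 2)) 1 ⊆ T := Finset.Subset.refl _
  have hΛ : ({0} : Finset (Site 2)) ⊆ T := subset_thicken _ _
  have hz : (0 : Site 2) ∈ T := hΛ (Finset.mem_singleton_self 0)
  have hP : pairRegion (insert (0 : Site 2) unitSteps) 0 ⊆ T := by
    intro x hx
    rw [pairRegion, Finset.mem_insert, Finset.mem_image] at hx
    rcases hx with rfl | ⟨e, he, rfl⟩
    · exact zero_mem_thicken_zero 1
    · rw [Finset.mem_insert] at he
      rcases he with rfl | he
      · rw [add_zero]; exact zero_mem_thicken_zero 1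
      · rw [zero_add]
        simp only [unitSteps, Finset.mem_insert, Finset.mem_singleton] at he
        rcases he with rfl | rfl | rfl | rfl
        · exact unitVec_mem_thicken_one (d := 2) 0
        · exact neg_unitVec_mem_thicken_one (d := 2) 0
        · exact unitVec_mem_thicken_one (d := 2) 1
        · exact neg_unitVec_mem_thicken_one (d := 2) 1
  have hδ : 0 < h₂ - h := by linarith
  have hκ : 0 ≤ 1 / (h₂ - h) := by positivity
  have hmain := hmin.re_sum_twistedFlipAct_expect_ge_of_sourced_certificate_kkt_fieldRows hΛ h0 h0 hz
    (-(fermionEmbed (PolySite.incl hP) (localPairAt (insert (0 : Site 2) unitSteps) dWaveFormFactor 0) +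
      (fermionEmbed (PolySite.incl hP) (localPairAt (insert (0 : Site 2) unitSteps) dWaveFormFactor 0))ᴴ))
    (1 / (h₂ - h)) 0 u 0 (fun _ => 0) 0 (hmin.mul_meanEnergy_sourced_le_of_le hκ hu) (fun _ _ _ => by simp only [zero_mul, le_refl])
    (Finset.univ : Finset Unit) (fun _ => 1 / (h₂ - h)) (fun _ => h₂) (fun _ => ℓ₂)
    (fun σ hσ _ j _ => InfVolFermionState.mul_le_mul_meanEnergy_sourced_of_dWaveSourceEnergyDensityTT'_ge hκ hℓ σ hσ)
    (m := Fin 0) (Λm := 0) Matrix.PosSemidef.zero (fun _ => 0) (κ' := Fin 0) ∅ Fin.elim0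
    (ι := Fin 0) ∅ Fin.elim0 Fin.elim0 Fin.elim0 Fin.elim0 (fun l => l.elim0) Fin.elim0 Fin.elim0
    (δ := Fin 0) ∅ Fin.elim0 Fin.elim0 (κ'' := Fin 0) ∅ Fin.elim0 Fin.elim0
    (β := Fin 0) (G := 0) Matrix.PosSemidef.zero Fin.elim0 (c := (ℓ₂ - u) / (h₂ - h)) (by
      have hsub := fermionEmbed_meanEnergyObs_sourced_sub_eq_smul_localPairAt 1 t' U μ h h₂ h0 hP
      simp only [gramForm, kktForm, Finset.univ_eq_empty, Finset.sum_empty, Finset.sum_const_zero, Complex.ofReal_zero, zero_smul,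
        sub_zero, add_zero, Fintype.univ_ofSubsingleton, Finset.sum_singleton]
      rw [sub_eq_iff_eq_add.1 hsub]
      have hk : (((1 / (h₂ - h) : ℝ)) : ℂ) * ((h - h₂ : ℝ) : ℂ) = -1 := by
        rw [← Complex.ofReal_mul, show (1 / (h₂ - h)) * (h - h₂) = (-1 : ℝ) by field_simp; ring, Complex.ofReal_neg,
          Complex.ofReal_one]
      have hc : (((ℓ₂ - u) / (h₂ - h) : ℝ) : ℂ) = (((1 / (h₂ - h) : ℝ)) : ℂ) * ((ℓ₂ - u : ℝ) : ℂ) := by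
        rw [← Complex.ofReal_mul]; congr 1; ring
      have hkd : ∀ Y : FermionOp T, (((1 / (h₂ - h) : ℝ)) : ℂ) • (((h - h₂ : ℝ) : ℂ) • Y) = -Y := fun Y => by
        rw [smul_smul, hk, neg_one_smul]
      rw [hc]
      simp only [smul_sub, smul_add, hkd]
      push_cast
      module)
  simp_rw [map_neg, Complex.neg_re, InfVolFermionState.re_expect_fermionEmbed_localPairAt_add_conjTranspose, Finset.sum_neg_distrib,
    ← Finset.mul_sum, ω₀.sum_re_expect_localPairAt_dWave_twistedFlipAct] at hmain
  simp only [Finset.sum_empty, sub_zero, Finset.sum_const_zero, zero_mul, add_zero] at hmain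
  have hflip : (ℓ₂ - u) / (h₂ - h) = -((u - ℓ₂) / (h₂ - h)) := by ring
  linarith

end Literature.MathematicalPhysics.QuantumLattice

end
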